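import Literature.IUT.LogVolume.HaarTransport
import Literature.IUT.LogVolume.PadicModuleTopology
import HarnessLib

/-!
# `ℚ_p`-linear lattice isomorphisms of finite-dimensional `ℚ_p`-vector spaces preserve normalised Haar
# measures (Dupuy–Hilado §4.9 footnote; §4.7 "(Ind1) fixes the lattice")

Dupuy–Hilado, *The statement of Mochizuki's Corollary 3.12…*, arXiv:2004.13228, §4.9 footnote, read on
the page: "Invertible linear maps on finite dimensional `ℚ_p`-vector spaces have determinant one. This
means the distortion factor (the determinant) is 1 and the measure of sets are preserved under these maps."
— for the maps in question, the "`ℚ_p`-vector space automorphisms which arise as `ℤ_p`-lattice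
isomorphisms"; §4.7: the (Ind1) permutation of tensor factors "is `ℚ_p`-linear and fixes the lattice".
[IUTchIV] Thm. 1.10 Step (v) (kurims p. 27): "(Ind1) and (Ind2) are taken into account by the arbitrary
nature of the [`ℚ_p`-linear, lattice-preserving] automorphism "`φ`"".

This proof-only file states the footnote as THEOREMS in the `ℚ_p`-LINEAR category, on top of abc-iut-S7's
`PadicModuleTopology.lean` (finite-dimensional `ℚ_p`-spaces with Mathlib's module topology; basis
lattices as `IntegralStructure`s) and `HaarTransport.lean` (Haar transport / lattice-automorphism
invariance for bicontinuous additive isomorphisms): every `ℚ_p`-linear map out of a module-topology space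
is continuous (`IsModuleTopology.continuous_of_linearMap`), so a `ℚ_p`-linear equivalence IS a
bicontinuous additive isomorphism and the transport theorems apply verbatim —

* `haar_image_linearEquiv_of_image_eq` (+ `logVolume_…`, `normalizedLogVolume_…`): a linear equivalence
  `φ : W ≃ W'` carrying the integral structure `Λ` onto `Λ'` carries `μ_Λ` to `μ_{Λ'}` — the (Ind1) shape
  (the tensor packet with permuted index tuple is carried, `ℚ_p`-linearly, onto the tensor packet,
  lattice onto lattice);
* `haar_image_linearEquiv_of_preserves` (+ log forms, `haar_image_self_linearEquiv_of_preserves`): a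
  linear automorphism `φ : W ≃ W` mapping SOME compact open subgroup onto itself preserves EVERY
  normalised Haar measure on `W` ("determinant one") — the (Ind2) shape; `…_basisLattice` — the case of
  the `ℤ_p`-lattice of a basis.

Written by the wave-3 discharge seat abc-iut-c312-d1 (cell abc-iut), for the campaign-S tensor-packet
files (`TensorPacketRing`/`TensorPacketHaar`/`TensorPacketVolume`: `V = ⊗_{ℚ_p} k_i` carries the module
topology) and the summit-side `LogvolInvariant` instances. [cite: DupuyHilado2025, §4.7, §4.9]
Deliberately NOT here: the tensor packets themselves, the determinant formula for the modulus of a general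
linear automorphism, anything disputed.
-/

noncomputable section

open MeasureTheory Set

namespace Literature.IUT.LogVolume

namespace PadicModule

variable (p : ℕ) [Fact p.Prime]
variable {W W' : Type*} [AddCommGroup W] [Module ℚ_[p] W] [TopologicalSpace W] [IsModuleTopology ℚ_[p] W]
  [IsTopologicalAddGroup W] [MeasurableSpace W] [BorelSpace W]
  [AddCommGroup W'] [Module ℚ_[p] W'] [TopologicalSpace W'] [IsModuleTopology ℚ_[p] W']
  [IsTopologicalAddGroup W'] [MeasurableSpace W'] [BorelSpace W']

/-! ### Transport along a `ℚ_p`-linear equivalence carrying lattice to lattice ((Ind1) shape) -/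

/-- **`ℚ_p`-linear Haar transport**: a `ℚ_p`-linear equivalence `φ : W ≃ W'` of finite-dimensional
`ℚ_p`-vector spaces (module topology) carrying the integral structure `Λ` onto `Λ'` satisfies
`μ_{Λ'}(φ(A)) = μ_Λ(A)` for every `A` — `φ` and `φ⁻¹` are automatically continuous.
[cite: DupuyHilado2025, §4.7] -/
theorem haar_image_linearEquiv_of_image_eq (Λ : IntegralStructure W) (Λ' : IntegralStructure W')
    (φ : W ≃ₗ[ℚ_[p]] W') (hφ : φ '' (Λ : Set W) = (Λ' : Set W')) (A : Set W) :
    Λ'.haar (φ '' A) = Λ.haar A :=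
  haveI : ContinuousAdd W' := IsModuleTopology.toContinuousAdd ℚ_[p] W'
  haveI : ContinuousAdd W := IsModuleTopology.toContinuousAdd ℚ_[p] W
  Λ.haar_image_equiv Λ'
    { φ.toAddEquiv with
      continuous_toFun := IsModuleTopology.continuous_of_linearMap φ.toLinearMap
      continuous_invFun := IsModuleTopology.continuous_of_linearMap φ.symm.toLinearMap } hφ A

/-- Log form: `μ^log_{Λ'}(φ(A)) = μ^log_Λ(A)`. [cite: DupuyHilado2025, §4.7] -/
theorem logVolume_image_linearEquiv_of_image_eq (Λ : IntegralStructure W) (Λ' : IntegralStructure W')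
    (φ : W ≃ₗ[ℚ_[p]] W') (hφ : φ '' (Λ : Set W) = (Λ' : Set W')) (A : Set W) :
    Λ'.logVolume (φ '' A) = Λ.logVolume A := by
  simp only [IntegralStructure.logVolume, haar_image_linearEquiv_of_image_eq p Λ Λ' φ hφ]

/-- Normalised log form (same weight, e.g. `dim_{ℚ_p} W = dim_{ℚ_p} W'`): `μ^log_{Λ'}(φ(A))/d = μ^log_Λ(A)/d`.
[cite: DupuyHilado2025, §4.7] -/
theorem normalizedLogVolume_image_linearEquiv_of_image_eq (d : ℕ) (Λ : IntegralStructure W)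
    (Λ' : IntegralStructure W') (φ : W ≃ₗ[ℚ_[p]] W') (hφ : φ '' (Λ : Set W) = (Λ' : Set W'))
    (A : Set W) : Λ'.normalizedLogVolume d (φ '' A) = Λ.normalizedLogVolume d A := by
  simp only [IntegralStructure.normalizedLogVolume, logVolume_image_linearEquiv_of_image_eq p Λ Λ' φ hφ]

/-! ### Linear lattice automorphisms preserve every normalised Haar measure ((Ind2) shape) -/

/-- **"Determinant one"**: a `ℚ_p`-linear automorphism `φ` of `W` mapping SOME compact open subgroup
`Λ₀` (a `ℤ_p`-lattice) onto itself preserves every normalised Haar measure: `μ_Λ(φ(A)) = μ_Λ(A)` for all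
`A` and all integral structures `Λ`. [cite: DupuyHilado2025, §4.9] -/
theorem haar_image_linearEquiv_of_preserves (Λ : IntegralStructure W) (φ : W ≃ₗ[ℚ_[p]] W)
    (Λ₀ : IntegralStructure W) (hφ : φ '' (Λ₀ : Set W) = (Λ₀ : Set W)) (A : Set W) :
    Λ.haar (φ '' A) = Λ.haar A :=
  haveI : ContinuousAdd W := IsModuleTopology.toContinuousAdd ℚ_[p] W
  Λ.haar_image_of_preserves
    { φ.toAddEquiv with
      continuous_toFun := IsModuleTopology.continuous_of_linearMap φ.toLinearMap
      continuous_invFun := IsModuleTopology.continuous_of_linearMap φ.symm.toLinearMap } Λ₀ hφ A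

/-- In particular such a `φ` has Haar modulus one: `μ_Λ(φ(Λ)) = 1`. [cite: DupuyHilado2025, §4.9] -/
theorem haar_image_self_linearEquiv_of_preserves (Λ : IntegralStructure W) (φ : W ≃ₗ[ℚ_[p]] W)
    (Λ₀ : IntegralStructure W) (hφ : φ '' (Λ₀ : Set W) = (Λ₀ : Set W)) :
    Λ.haar (φ '' (Λ : Set W)) = 1 := by
  rw [haar_image_linearEquiv_of_preserves p Λ φ Λ₀ hφ, IntegralStructure.haar_self]

/-- Log form: `μ^log_Λ(φ(A)) = μ^log_Λ(A)` for a linear lattice automorphism `φ`.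
[cite: DupuyHilado2025, §4.9] -/
theorem logVolume_image_linearEquiv_of_preserves (Λ : IntegralStructure W) (φ : W ≃ₗ[ℚ_[p]] W)
    (Λ₀ : IntegralStructure W) (hφ : φ '' (Λ₀ : Set W) = (Λ₀ : Set W)) (A : Set W) :
    Λ.logVolume (φ '' A) = Λ.logVolume A := by
  simp only [IntegralStructure.logVolume, haar_image_linearEquiv_of_preserves p Λ φ Λ₀ hφ]

/-- Normalised log form (`log μ̄ := log μ / dim_{ℚ_p}`, Dupuy–Hilado §3.4): `μ^log_Λ(φ(A))/d = μ^log_Λ(A)/d`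
for a linear lattice automorphism `φ`. [cite: DupuyHilado2025, §4.9] -/
theorem normalizedLogVolume_image_linearEquiv_of_preserves (d : ℕ) (Λ : IntegralStructure W)
    (φ : W ≃ₗ[ℚ_[p]] W) (Λ₀ : IntegralStructure W) (hφ : φ '' (Λ₀ : Set W) = (Λ₀ : Set W)) (A : Set W) :
    Λ.normalizedLogVolume d (φ '' A) = Λ.normalizedLogVolume d A := by
  simp only [IntegralStructure.normalizedLogVolume, logVolume_image_linearEquiv_of_preserves p Λ φ Λ₀ hφ]

/-- The case of the `ℤ_p`-lattice of a basis: a linear automorphism with `φ(L_b) = L_b`,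
`L_b = basisLattice b`, preserves every normalised Haar measure on `W`. [cite: DupuyHilado2025, §4.9] -/
theorem haar_image_linearEquiv_of_image_basisLattice_eq {ι : Type*} [Fintype ι]
    (b : Module.Basis ι ℚ_[p] W) (Λ : IntegralStructure W) (φ : W ≃ₗ[ℚ_[p]] W)
    (hφ : φ '' (basisLattice p b : Set W) = basisLattice p b) (A : Set W) :
    Λ.haar (φ '' A) = Λ.haar A :=
  haar_image_linearEquiv_of_preserves p Λ φ (basisIntegralStructure p b) hφ A

end PadicModule

end Literature.IUT.LogVolume

end
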